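import Mathlib
import Literature.Computability.Complexity.Classes
import Literature.Computability.Complexity.Nondeterministic
import Literature.Computability.Complexity.Randomized
import Literature.Computability.Complexity.ProbabilisticClasses
import Literature.Computability.Complexity.Oracle
import Literature.Computability.Complexity.CNF
import Literature.Computability.Complexity.TimeBounds
import Literature.Computability.Complexity.BoolEncodings
import Literature.Computability.MetaComplexity.Fu2020.RandomizedStreamingMagnification
import Literature.Computability.MetaComplexity.ChenJinSanthanamWilliams2022.StreamingRefuterMagnification
import HarnessLib

/-!
# Chen–Jin–Santhanam–Williams (FOCS 2021), Theorem 1.3: `P^NP` refuters against small-space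
# randomized streaming algorithms for ANY `NP` language ⇒ `EXP^NP ≠ BPP` (census row R65)

Source: L. Chen, C. Jin, R. Santhanam, R. Williams, *Constructive separations and their
consequences*, FOCS 2021 (bib key `ChenEtAl2022`; held text `paper:arxiv-2203.14379`, the
theorem is `theo:PNP-constructive-to-EXPNP-lowb`, p. 5).

Verbatim (p0005 L14): *"Let f(n) ≥ ω(1). For every language L ∈ NP, a P^NP-constructive
separation of L from uniform randomized streaming algorithms with O(n · (log n)^{f(n)}) time and
O(log n)^{f(n)} space implies EXP^NP ≠ BPP."* Refuters (p0005 L8–12): *"P^NP-refuters against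
streaming algorithms, which are deterministic polynomial time algorithms given a SAT oracle that
output counterexamples for streaming algorithms on infinitely many input lengths"*; Def. 1
(p0003 L19–33): a refuter *"given input 1ⁿ, prints a string x ∈ {0,1}ⁿ, such that for infinitely
many n, A(x) ≠ f(x)"*, a constructive separation of `f ∉ 𝒞` = *"for every algorithm A computable
in 𝒞, there is a refuter for f against A"*, and the refuted randomized algorithms have *"bounded
probability gap"* (p0003 L35).

## Rendering (direction F2: the typed statement is WEAKER than print)

* Refuted class ENLARGED exactly as for Thm. 1.4 (row R36, `PolylogSpaceStreaming f` of
  `StreamingRefuterMagnification.lean`): all `Fu2020.RStreamingAlgorithm`s storing at most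
  `c (log₂ N)^{f N} + c` bits — time bound, uniformity and the probability-gap convention dropped;
  print's class at growth rate `f' = ⌊f/2⌋` is contained in ours at rate `f` (`(c' log n)^{f'(n)} ≤
  (log n)^{f(n)}` for `log n ≥ c'`, finitely many lengths absorbed in `+ c`), and print's theorem
  holds for every `f' ≥ ω(1)`. Refuting MORE algorithms is a STRONGER hypothesis.
* Failure of `A` on `w` (`StreamFailsOn`): `Pr_coins[A answers "w ∈ L" correctly] < 2/3`; for a
  gapped algorithm this is exactly print's `A(w) ≠ L(w)`.
* Refuter (`HasPNPStreamRefuter`): a string function `R ∈ FP^SAT` (tree `FPRel (Oracle.ofLanguage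
  SAT)`, `Complexity/Oracle.lean`) with `|R(1ⁿ)| = n` for EVERY `n` (print's length requirement,
  p0004 L3) and `A` failing on `R(1ⁿ)` for infinitely many `n` — print's notion verbatim over the
  tree's oracle-algorithm model.
* Conclusion: `EXPNP ≠ BPP` with the cell-local definition D14 `EXPRel O` below (relativised
  exponential time over the tree's `OracleAlg` transcripts: per-step time `2^{|x|^k + k}` measured
  on the INPUT `x`, at most `2^{|x|^k + k}` rounds and query length). `EXPRel (ofLanguage SAT)`
  CONTAINS textbook `EXP^NP` (an exponential-time oracle machine is re-simulated from the
  transcript at every round within the per-step budget), and `BPP ⊆ EXP^NP`; hence print's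
  `EXP^NP ≠ BPP` implies the typed `EXPNP ≠ BPP` — the conclusion is typed WEAKER-or-equal, never
  stronger. (Total time of an `EXPRel` computation is `2^{O(|x|^k)}`, so the class is not
  trivially larger than `EXP^NP` either; adequacy of `OracleAlg` itself: module docstring of
  `Complexity/Oracle.lean`.)

Proved here (rule F1, non-vacuity): the refuted class is inhabited (`rejectAll_mem`, R36 file);
the refuter condition FAILS for an empty language against `rejectAll`
(`not_hasPNPStreamRefuter_of_forall_not_mem`, instance `not_forall_hasPNPStreamRefuter_empty`),
so the hypothesis of Thm. 1.3 is not vacuously dischargeable; every member of `L` is a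
counterexample against `rejectAll` (`streamFailsOn_rejectAll_of_mem`), and given that the identity
string function lies in `FP^SAT` the refuter condition HOLDS for any language containing all `1ⁿ`
(`hasPNPStreamRefuter_rejectAll_of_mem`). HONEST FRAMING: a typed census row (constructivity gap:
hard inputs exist non-constructively — row R36's KNOWN column — versus `P^NP`-printable hard
inputs); nothing here is an approach to the summit.
-/

noncomputable section

namespace Literature.Computability.MetaComplexity.ChenJinSanthanamWilliams2022

open Filter _root_.Computability
open Literature.Computability.Complexity Literature.Computability.Complexity.Nondeterministic

/-! ### D14 — relativised exponential time over the tree's oracle algorithms -/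

/-- **D14 (step budget).** The step function of the oracle algorithm `M` (input and answers so far
↦ next query or output, encoded as in `OracleAlg.IsPolyTime`) is computable by a multi-stack
machine within `2^{|x|^k + k}` steps, the budget measured on the INPUT `x` of the pair
`(x, answers)` (not on the transcript length). [folklore] -/
def StepExpTime {β : Type} (M : OracleAlg β) (eb : Encoding β Bool) (k : ℕ) : Prop :=
  ∃ T : Turing.TM2ComputableAux Bool Bool,
    ComputesInTime
      (fun p : List Bool × List (List Bool) => boolPair p.1 ((encodingList Bool).listBool.encode p.2))
      ((encodingList Bool).sumBool eb).encode (Function.uncurry M.step)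
      (fun p => 2 ^ (p.1.length ^ k + k)) T

/-- **D14 (`EXP^O`).** `EXPRel O`: languages decided by an oracle algorithm with oracle `O` whose
step function has an exponential step budget `2^{|x|^k + k}` (`StepExpTime`), within
`2^{|x|^k + k}` rounds and with queries of length at most `2^{|x|^k + k}` — the exponential
analogue of the tree's `PRel O` (`Complexity/Oracle.lean`). Cell-local rendering of `EXP^O`;
it contains the textbook class (re-simulation from the transcript fits the step budget).
[cite: AroraBarak2009, §3.4 Def. 3.4 (oracle TMs) with §2.6.2 (EXP)] -/
def EXPRel (O : Oracle) : Set (Language Bool) :=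
  {L | ∃ M : OracleAlg Bool, ∃ k : ℕ, StepExpTime M encodingBoolBool k ∧
    ∀ x : List Bool,
      M.run O (2 ^ (x.length ^ k + k)) x = some (L.boolIndicator x) ∧
        ∀ y ∈ M.queries O (2 ^ (x.length ^ k + k)) x, y.length ≤ 2 ^ (x.length ^ k + k)}

/-- **D14 (`EXP^NP`).** `EXPNP := EXPRel (Oracle.ofLanguage SAT)` — exponential time with a `SAT`
oracle. [cite: AroraBarak2009, §3.4 (oracle machines; `EXP^{NP}` via a SAT oracle)] -/
def EXPNP : Set (Language Bool) :=
  EXPRel (Oracle.ofLanguage SAT)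

/-! ### Failure, `P^NP` refuters, the theorem -/

/-- **`A` fails on `w` for `L`**: the probability (over `A`'s coins at length `|w|`) that `A`'s
verdict agrees with `w ∈ L` is below `2/3` (for an algorithm with bounded probability gap this is
print's "A(w) ≠ L(w)", p0003 L35). [cite: ChenEtAl2022, Def. 1 (refuters: A(x) ≠ f(x)), p.3] -/
def StreamFailsOn (A : Fu2020.RStreamingAlgorithm) (L : Language Bool) (w : List Bool) : Prop :=
  uniformProb (A.coinLen w.length) {y : List Bool | A.acceptsWith w y = true ↔ w ∈ L} < 2 / 3

/-- **`P^NP` refuter for `L` against `A`** (p0005 L8–12 with Def. 1, p0003): a string function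
`R ∈ FP^SAT` printing on `1ⁿ` a string of length exactly `n` (every `n`), on which `A` fails for
infinitely many `n`. [cite: ChenEtAl2022, §1 p.5 L8–12 (P^NP-refuters against streaming algorithms)] -/
def HasPNPStreamRefuter (L : Language Bool) (A : Fu2020.RStreamingAlgorithm) : Prop :=
  ∃ R ∈ FPRel (Oracle.ofLanguage SAT),
    (∀ n : ℕ, (R (List.replicate n true)).length = n) ∧
      ∃ᶠ n in atTop, StreamFailsOn A L (R (List.replicate n true))

/-- **[CJSW21, Thm. 1.3]** (typed WEAKER than print, see the module docstring): for every `f`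
tending to infinity and every `L ∈ NP`, if EVERY randomized one-pass streaming algorithm storing
`O((log₂ N)^{f(N)})` bits admits a `P^NP` refuter for `L`, then `EXP^NP ≠ BPP`. Verbatim
(p0005 L14): *"Let f(n) ≥ ω(1). For every language L ∈ NP, a P^NP-constructive separation of L
from uniform randomized streaming algorithms with O(n · (log n)^{f(n)}) time and O(log n)^{f(n)}
space implies EXP^NP ≠ BPP."* [cite: ChenEtAl2022, Thm. 1.3 (theo:PNP-constructive-to-EXPNP-lowb), p.5] -/
def thm13 : Prop :=
  ∀ f : ℕ → ℕ, Tendsto f atTop atTop → ∀ L ∈ NP,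
    (∀ A ∈ PolylogSpaceStreaming f, HasPNPStreamRefuter L A) → EXPNP ≠ BPP

/-! ### Proved: calibration of the refuter condition (rule F1) -/

/-- An algorithm DECIDING `L` with error `1/3` fails on no input. [folklore] -/
theorem not_streamFailsOn_of_decidesBP {A : Fu2020.RStreamingAlgorithm} {L : Language Bool}
    (h : A.DecidesBP L) (w : List Bool) : ¬ StreamFailsOn A L w :=
  not_lt.mpr (h w)

/-- Conversely, an algorithm that does NOT decide `L` fails on some input — the NON-constructive
form of a counterexample, which a refuter must PRINT. [folklore] -/
theorem exists_streamFailsOn_of_not_decidesBP {A : Fu2020.RStreamingAlgorithm} {L : Language Bool}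
    (h : ¬ A.DecidesBP L) : ∃ w : List Bool, StreamFailsOn A L w := by
  by_contra hne
  exact h fun w => not_lt.mp fun hw => hne ⟨w, hw⟩

/-- A refuter against `A` for `L` forces `A` not to decide `L`. [folklore] -/
theorem not_decidesBP_of_hasPNPStreamRefuter {A : Fu2020.RStreamingAlgorithm} {L : Language Bool}
    (h : HasPNPStreamRefuter L A) : ¬ A.DecidesBP L := by
  obtain ⟨R, -, -, hR⟩ := h
  obtain ⟨n, hn⟩ := hR.exists
  exact fun hdec => not_streamFailsOn_of_decidesBP hdec _ hn

/-- `rejectAll` decides every EMPTY language (one with no members). [folklore] -/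
theorem rejectAll_decidesBP_of_forall_not_mem {L : Language Bool} (hL : ∀ w, w ∉ L) :
    Fu2020.Trivial.rejectAll.DecidesBP L := by
  intro x
  have e : {y : List Bool | Fu2020.Trivial.rejectAll.acceptsWith x y = true ↔ x ∈ L} = Set.univ := by
    ext y; simp [hL x]
  rw [e, uniformProb_univ]; norm_num

/-- **F1 (the refuter condition is not automatic):** no `P^NP` refuter exists for an empty
language against `rejectAll ∈ PolylogSpaceStreaming f`. [folklore] -/
theorem not_hasPNPStreamRefuter_of_forall_not_mem {L : Language Bool} (hL : ∀ w, w ∉ L) :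
    ¬ HasPNPStreamRefuter L Fu2020.Trivial.rejectAll :=
  fun h => not_decidesBP_of_hasPNPStreamRefuter h (rejectAll_decidesBP_of_forall_not_mem hL)

/-- Hence the hypothesis of Thm. 1.3 FAILS for an empty language, for every growth rate `f`: it is
a genuine condition on `L`, not dischargeable for free. [folklore] -/
theorem not_forall_hasPNPStreamRefuter_of_forall_not_mem {L : Language Bool} (hL : ∀ w, w ∉ L)
    (f : ℕ → ℕ) : ¬ ∀ A ∈ PolylogSpaceStreaming f, HasPNPStreamRefuter L A :=
  fun h => not_hasPNPStreamRefuter_of_forall_not_mem hL (h _ (rejectAll_mem f))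

/-- The instance `L = ∅`. [folklore] -/
theorem not_forall_hasPNPStreamRefuter_empty (f : ℕ → ℕ) :
    ¬ ∀ A ∈ PolylogSpaceStreaming f, HasPNPStreamRefuter ((∅ : Set (List Bool)) : Language Bool) A :=
  not_forall_hasPNPStreamRefuter_of_forall_not_mem (fun _ h => h) f

/-- Every MEMBER of `L` is a counterexample against `rejectAll`. [folklore] -/
theorem streamFailsOn_rejectAll_of_mem {L : Language Bool} {w : List Bool} (hw : w ∈ L) :
    StreamFailsOn Fu2020.Trivial.rejectAll L w := by
  unfold StreamFailsOn
  have e : {y : List Bool | Fu2020.Trivial.rejectAll.acceptsWith w y = true ↔ w ∈ L} = ∅ := by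
    ext y; simp [hw]
  rw [e, uniformProb_empty]; norm_num

/-- **F1 (the refuter condition is satisfiable):** if the identity string function lies in
`FP^SAT` (membership of concrete functions in the tree's `FPRel` is routed through
`OracleAlg.isPolyTime_ofFun`), then `1ⁿ ↦ 1ⁿ` is a `P^NP` refuter against `rejectAll` for every
language containing all the strings `1ⁿ` (e.g. the full language). [folklore] -/
theorem hasPNPStreamRefuter_rejectAll_of_mem {L : Language Bool}
    (hL : ∀ n : ℕ, List.replicate n true ∈ L)
    (hid : (fun x : List Bool => x) ∈ FPRel (Oracle.ofLanguage SAT)) :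
    HasPNPStreamRefuter L Fu2020.Trivial.rejectAll :=
  ⟨fun x => x, hid, fun n => by simp,
    Filter.Frequently.of_forall fun n => streamFailsOn_rejectAll_of_mem (hL n)⟩

/-- The separation packaged: Thm. 1.3 + an `NP` language with `P^NP` refuters against the whole
class gives `EXP^NP ≠ BPP`. [folklore] -/
theorem EXPNP_ne_BPP_of_thm13 (hT : thm13) {f : ℕ → ℕ} (hf : Tendsto f atTop atTop)
    {L : Language Bool} (hL : L ∈ NP) (h : ∀ A ∈ PolylogSpaceStreaming f, HasPNPStreamRefuter L A) :
    EXPNP ≠ BPP :=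
  hT f hf L hL h

end Literature.Computability.MetaComplexity.ChenJinSanthanamWilliams2022

end
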